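import Mathlib
import Summits.AnomalousDissipation.AnomalousDissipation.Theorems.SoloBlindGlue
import Summits.AnomalousDissipation.AnomalousDissipation.Theorems.SoloBlindTailBoxTail

/-!
# (T2) assembly: certified box ⊕ tail lemmas ⊕ contraction ⇒ a global member (solo-blind, PLAN §82/§83)

This file composes kernel #122 (`glue3_hasDerivAt`, gluing ODE solutions at matching points) with
kernel #123 (`matching_fixedPoint`, the finite-dimensional matching equation) into the LOGICAL SHAPE
of the (T2) theorem for the canonical landing member.

Data. `f` is the (time-dependent) vector field of the inner landing system on the state space `F`;
`a < b` are the matching points (`a = -X₁`, `b = X₂`). The uniform box theorem (K) provides, for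
every row value `r` in an admissible complete set `s ⊆ E`, a validated solution `yB r` on `[a, b]`
whose pair of end states is `chart (box r) + lift r` (`box r ∈ P` = the observables the tails are
parametrised by, e.g. `(c₀, s)` on the left and the decaying amplitudes on the right; `lift r` = the
row perturbation written in state coordinates). The tail lemmas (L), (R) provide, for every
parameter `p = box r`, solutions `yL p` on `(-∞, a]` and `yR p` on `[b, ∞)` whose end states are
`chart p + lift (defect p)`. If `box` and `defect` are Lipschitz with `KD * KB < 1` and
`defect ∘ box` maps `s` into itself, then some row value `r ∈ s` is matched, and the three pieces
glue to a solution on all of `ℝ` which IS the certified box solution on `(a, b]` — so every constant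
certified for the box family on `s` (pins at `0`, signs, labels) is inherited by the member.
-/

namespace Summit.AnomalousDissipation.AnomalousDissipation.Theorems

open Set

/-- The assembled candidate for the row value `r`: left tail with parameter `box r` on `(-∞, a]`,
the box solution `yB r` on `(a, b]`, right tail with parameter `box r` on `(b, ∞)`. -/
noncomputable def assembledMember {E P F : Type*} (a b : ℝ) (box : E → P) (yB : E → ℝ → F)
    (yL yR : P → ℝ → F) (r : E) : ℝ → F :=
  glueAt b (glueAt a (yL (box r)) (yB r)) (yR (box r))

/-- **(T2) assembly theorem (abstract form).** Certified box family + tail lemmas + contraction of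
the matching map ⇒ there is a matched row value `r ∈ s` whose assembled candidate solves the ODE on
all of `ℝ`, coincides with the left tail on `(-∞, a]`, with the certified box solution on `(a, b]`,
and with the right tail on `(b, ∞)`. -/
theorem t2_assembly {E P F : Type*} [MetricSpace E] [MetricSpace P]
    [NormedAddCommGroup F] [NormedSpace ℝ F]
    (f : ℝ → F → F) {a b : ℝ} (hab : a < b)
    {s : Set E} (hs : IsComplete s) (hne : s.Nonempty)
    (box : E → P) (defect : P → E) {KB KD : NNReal}
    (hbox : LipschitzOnWith KB box s) (hdef : LipschitzOnWith KD defect (box '' s))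
    (hmaps : MapsTo (defect ∘ box) s s) (hcontr : KD * KB < 1)
    (yB : E → ℝ → F) (yL yR : P → ℝ → F)
    (hB : ∀ r ∈ s, ∀ t, a ≤ t → t ≤ b → HasDerivAt (yB r) (f t (yB r t)) t)
    (hL : ∀ r ∈ s, ∀ t ≤ a, HasDerivAt (yL (box r)) (f t (yL (box r) t)) t)
    (hR : ∀ r ∈ s, ∀ t, b ≤ t → HasDerivAt (yR (box r)) (f t (yR (box r) t)) t)
    (chart : P → F × F) (lift : E → F × F)
    (hboxstate : ∀ r ∈ s, (yB r a, yB r b) = chart (box r) + lift r)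
    (htailstate : ∀ r ∈ s, (yL (box r) a, yR (box r) b) = chart (box r) + lift (defect (box r))) :
    ∃ r ∈ s, defect (box r) = r ∧
      (∀ t, HasDerivAt (assembledMember a b box yB yL yR r)
          (f t (assembledMember a b box yB yL yR r t)) t) ∧
      (∀ t ≤ a, assembledMember a b box yB yL yR r t = yL (box r) t) ∧
      (∀ t, a < t → t ≤ b → assembledMember a b box yB yL yR r t = yB r t) ∧
      (∀ t, b < t → assembledMember a b box yB yL yR r t = yR (box r) t) := by
  obtain ⟨r, hr, hfix⟩ := matching_fixedPoint hs hne box defect hbox hdef hmaps hcontr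
  refine ⟨r, hr, hfix, ?_, ?_, ?_, ?_⟩
  · have hst : (yB r a, yB r b) = (yL (box r) a, yR (box r) b) := by
      rw [hboxstate r hr, htailstate r hr, hfix]
    have ha : yL (box r) a = yB r a := (congrArg Prod.fst hst).symm
    have hb' : yB r b = yR (box r) b := congrArg Prod.snd hst
    exact glue3_hasDerivAt f (yL (box r)) (yB r) (yR (box r)) a b hab (hL r hr) (hB r hr) (hR r hr)
      ha hb'
  · intro t ht; exact glue3_eq_left _ _ _ hab ht
  · intro t hat htb; exact glue3_eq_box _ _ _ hat htb
  · intro t hbt; exact glue3_eq_right _ _ _ hbt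

/-- **Inheritance of box-certified properties.** Whatever has been certified for EVERY box
solution of the admissible family at an interior time `t ∈ (a, b]` (e.g. the pins `(α, M)(0)` in a
ball, `α > 0`) holds for the assembled member at a matched row value. -/
theorem assembledMember_inherits {E P F : Type*} (a b : ℝ) (box : E → P) (yB : E → ℝ → F)
    (yL yR : P → ℝ → F) {s : Set E} (Q : ℝ → F → Prop)
    (hQ : ∀ r ∈ s, ∀ t, a < t → t ≤ b → Q t (yB r t)) {r : E} (hr : r ∈ s)
    {t : ℝ} (hat : a < t) (htb : t ≤ b) :
    Q t (assembledMember a b box yB yL yR r t) := by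
  unfold assembledMember
  rw [glue3_eq_box _ _ _ hat htb]
  exact hQ r hr t hat htb

/- Uniqueness of the matched row value is `matching_fixedPoint_unique` (kernel #123), used as is. -/

end Summit.AnomalousDissipation.AnomalousDissipation.Theorems
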